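import Summits.NavierStokesRegularity.NavierStokesRegularity.Theorems.TypeIIInviscidRelaxationAxisymSwirlRegularCoreReynoldsScaled
import HarnessLib

/-!
# Two-level inflow criterion with an ARBITRARILY THIN subcritical core (outer levels below `4`)

Helper toward the crux `OneSidedRadialCriterion` (stmt-NavierStokesRegularity-19059; line `subcritical_core_reynolds`,
stub `stub_subcriticalCoreReynolds`), criterion side; continues `…CoreReynoldsScaled.lean` (the rescaled profile
`F_{p,m}(ξ/ε)` and its admissible Reynolds profile `D_{p,m,ε}`).

* `scaledReynolds_ge_core` — `D_{p,m,ε} ≥ 2 − p` everywhere (the constant subcritical gate is contained);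
* `scaledReynolds_ge_gain` — `D_{p,m,ε}(ξ) ≥ (p/2−m)ξ²/(p + 2mξ²/ε²)`: beyond the radius where the outward similarity
  drift `ξ/2` beats the sink any level is admissible, the saturation `ε²(p/2−m)/(2m)` being free (`m ≪ ε²`);
* `scaledReynolds_ge_hump` — `D_{p,m,ε}(ξ) ≥ 4p(1−m)s²/((1+s²)(p+2ms²))`, `s = ξ/ε`: the level approaches `4` for
  `1 ≪ s`, `ms² ≪ p`, at ANY distance `ξ = εs` from the axis;
* `exists_thinCore_params`, `twoLevelReynolds_thinCore` — **for every core level `d₀ < 2`, every outer level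
  `Λ₀ < 4` and EVERY core width `ξ₀ > 0`**: Reynolds number `≤ d₀` where `r < ξ₀√(ν(T−t))` and `≤ Λ₀` where
  `r ≥ ξ₀√(ν(T−t))` (unit tube) ⇒ continuation past `T`.  The tree's `exists_coreWidth_twoLevelReynolds` allows any
  `Λ₀` but dictates the width `ξ₀(d₀,Λ₀) ≥ 1`; here the width is free and the outer level is capped by the hump.

Reading for ⟨19059⟩ (gate constant `C`): for `2 ≤ C < 4` the registered stub's «subcritical in EVERY parabolic core»
may be replaced by «subcritical in SOME parabolic core, however thin» — equivalently, a gated singularity with `C < 4`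
must carry inflow Reynolds numbers `≥ 2 − o(1)` at points with `r/√(ν(T−t)) → 0`, i.e. arbitrarily deep below the
parabolic scale.  (The cap `4` is this profile family's hump height `4(1−m)`, not a known threshold of the truth.)
Honest label: a regularity CRITERION; the open half `C ≥ 2` of ⟨19059⟩ is untouched; nothing here proves
`OneSidedRadialCriterion`, `AxisymSwirlRegular` or NavierStokesRegularity. [new]
-/

noncomputable section

set_option linter.dupNamespace false

open Set Filter Topology Real
open Literature.Analysis.FluidPDE

namespace Summit.NavierStokesRegularity.NavierStokesRegularity.Theorems.RadialInflowThinCore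

open Summit.NavierStokesRegularity.NavierStokesRegularity.Theorems
open Summit.NavierStokesRegularity.NavierStokesRegularity.Theorems.ZhangBarrier
open Summit.NavierStokesRegularity.NavierStokesRegularity.Theorems.RadialInflowSelfSimilar
open Summit.NavierStokesRegularity.NavierStokesRegularity.Theorems.RadialInflowCoreReynolds

/-! ## §1 The Reynolds profile `D_{p,m,ε}`: the core level, the similarity gain, the hump -/

/-- **`D_{p,m,ε} ≥ 2 − p` everywhere** (`0 < p`, `0 ≤ m ≤ p/2`, any `ε`, any `s = ξ/ε`):
`N − (2−p)(1+s²)(p+2ms²) = (p²+2p−2m(p+2))s² + 2m(p−2m)s⁴ + ε²(p/2−m)s²(1+s²) ≥ 0`. [new] -/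
theorem scaledReynolds_ge_core {p m : ℝ} (hp : 0 < p) (hm : 0 ≤ m) (hmp : m ≤ p / 2) (ε s : ℝ) :
    2 - p ≤ (p * (2 - p) + 4 * p * (1 - m) * s ^ 2 + 4 * m * (1 - m) * s ^ 4
        + ε ^ 2 * (p / 2 - m) * s ^ 2 * (1 + s ^ 2)) / ((1 + s ^ 2) * (p + 2 * m * s ^ 2)) := by
  have hQ : 0 < (1 + s ^ 2) * (p + 2 * m * s ^ 2) := by positivity
  rw [le_div_iff₀ hQ]
  have hq : 0 ≤ p / 2 - m := by linarith
  have h1 : 0 ≤ (p ^ 2 + 2 * p - 2 * m * (p + 2)) * s ^ 2 := by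
    have : 0 ≤ p ^ 2 + 2 * p - 2 * m * (p + 2) := by nlinarith
    positivity
  have h2 : 0 ≤ 2 * m * (p - 2 * m) * s ^ 4 := by
    have : 0 ≤ p - 2 * m := by linarith
    positivity
  have h3 : 0 ≤ ε ^ 2 * (p / 2 - m) * s ^ 2 * (1 + s ^ 2) := by positivity
  have key : (p * (2 - p) + 4 * p * (1 - m) * s ^ 2 + 4 * m * (1 - m) * s ^ 4
        + ε ^ 2 * (p / 2 - m) * s ^ 2 * (1 + s ^ 2)) - (2 - p) * ((1 + s ^ 2) * (p + 2 * m * s ^ 2))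
      = (p ^ 2 + 2 * p - 2 * m * (p + 2)) * s ^ 2 + 2 * m * (p - 2 * m) * s ^ 4
        + ε ^ 2 * (p / 2 - m) * s ^ 2 * (1 + s ^ 2) := by ring
  linarith

/-- **The similarity-confinement gain:** `D_{p,m,ε}(ξ) ≥ ε²(p/2−m)s²/(p+2ms²) = (p/2−m)ξ²/(p + 2mξ²/ε²)`
(`0 < p ≤ 2`, `0 ≤ m ≤ 1`): outside the radius where the outward similarity drift `ξ/2` beats the sink, any level is
admissible; the saturation value `ε²(p/2−m)/(2m)` is large for `m ≪ ε²`. [new] -/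
theorem scaledReynolds_ge_gain {p m : ℝ} (hp : 0 < p) (hp2 : p ≤ 2) (hm : 0 ≤ m) (hm1 : m ≤ 1) (ε s : ℝ) :
    ε ^ 2 * (p / 2 - m) * s ^ 2 / (p + 2 * m * s ^ 2)
      ≤ (p * (2 - p) + 4 * p * (1 - m) * s ^ 2 + 4 * m * (1 - m) * s ^ 4
        + ε ^ 2 * (p / 2 - m) * s ^ 2 * (1 + s ^ 2)) / ((1 + s ^ 2) * (p + 2 * m * s ^ 2)) := by
  have hb : 0 < 1 + s ^ 2 := by positivity
  have hc : 0 < p + 2 * m * s ^ 2 := by positivity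
  have e : ε ^ 2 * (p / 2 - m) * s ^ 2 / (p + 2 * m * s ^ 2)
      = ε ^ 2 * (p / 2 - m) * s ^ 2 * (1 + s ^ 2) / ((1 + s ^ 2) * (p + 2 * m * s ^ 2)) := by
    field_simp
  rw [e]
  refine div_le_div_of_nonneg_right ?_ (mul_pos hb hc).le
  have h1 : 0 ≤ p * (2 - p) := by nlinarith
  have h2 : 0 ≤ 4 * p * (1 - m) * s ^ 2 := by
    have : 0 ≤ 1 - m := by linarith
    positivity
  have h3 : 0 ≤ 4 * m * (1 - m) * s ^ 4 := by
    have : 0 ≤ 1 - m := by linarith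
    positivity
  linarith

/-- **The hump:** `D_{p,m,ε}(ξ) ≥ 4p(1−m)s²/((1+s²)(p+2ms²))` (`0 < p ≤ 2`, `0 ≤ m ≤ min 1 (p/2)`): in the range
`1 ≪ s`, `ms² ≪ p` the admissible level approaches `4(1−m)`, at ANY distance `ξ = εs` from the axis. [new] -/
theorem scaledReynolds_ge_hump {p m : ℝ} (hp : 0 < p) (hp2 : p ≤ 2) (hm : 0 ≤ m) (hm1 : m ≤ 1)
    (hmp : m ≤ p / 2) (ε s : ℝ) :
    4 * p * (1 - m) * s ^ 2 / ((1 + s ^ 2) * (p + 2 * m * s ^ 2))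
      ≤ (p * (2 - p) + 4 * p * (1 - m) * s ^ 2 + 4 * m * (1 - m) * s ^ 4
        + ε ^ 2 * (p / 2 - m) * s ^ 2 * (1 + s ^ 2)) / ((1 + s ^ 2) * (p + 2 * m * s ^ 2)) := by
  have hQ : 0 < (1 + s ^ 2) * (p + 2 * m * s ^ 2) := by positivity
  refine div_le_div_of_nonneg_right ?_ hQ.le
  have h1 : 0 ≤ p * (2 - p) := by nlinarith
  have h3 : 0 ≤ 4 * m * (1 - m) * s ^ 4 := by
    have : 0 ≤ 1 - m := by linarith
    positivity
  have h4 : 0 ≤ ε ^ 2 * (p / 2 - m) * s ^ 2 * (1 + s ^ 2) := by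
    have : 0 ≤ p / 2 - m := by linarith
    positivity
  linarith

/-! ## §2 Outer levels below `4`: an ARBITRARILY THIN subcritical core -/

/-- Hump case (pure algebra): with `Λ₀ ≤ 4(1−3δ)`, `0 < δ`, `m ≤ δ`, `δ s² ≥ 1` and `2ms² ≤ pδ/2`,
`Λ₀ ≤ 4p(1−m)s²/((1+s²)(p+2ms²))`. -/
theorem hump_case {p m δ Λ₀ s : ℝ} (hp : 0 < p) (hm : 0 ≤ m) (hδ : 0 < δ) (hmδ : m ≤ δ)
    (hΛ : Λ₀ ≤ 4 * (1 - 3 * δ)) (hΛ0 : 0 ≤ Λ₀) (hs : 1 ≤ δ * s ^ 2) (hms : 2 * m * s ^ 2 ≤ p * δ / 2) :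
    Λ₀ ≤ 4 * p * (1 - m) * s ^ 2 / ((1 + s ^ 2) * (p + 2 * m * s ^ 2)) := by
  have hQ : 0 < (1 + s ^ 2) * (p + 2 * m * s ^ 2) := by positivity
  rw [le_div_iff₀ hQ]
  have h1 : 1 + s ^ 2 ≤ (1 + δ) * s ^ 2 := by nlinarith
  have h2 : p + 2 * m * s ^ 2 ≤ p * (1 + δ / 2) := by linarith
  have h3 : Λ₀ * ((1 + s ^ 2) * (p + 2 * m * s ^ 2)) ≤ Λ₀ * (((1 + δ) * s ^ 2) * (p * (1 + δ / 2))) := by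
    refine mul_le_mul_of_nonneg_left ?_ hΛ0
    exact mul_le_mul h1 h2 (by positivity) (by positivity)
  have h4 : (1 - 3 * δ) * (1 + δ) * (1 + δ / 2) ≤ 1 - δ := by nlinarith [sq_nonneg δ, mul_pos hδ hδ]
  have h5 : Λ₀ * (((1 + δ) * s ^ 2) * (p * (1 + δ / 2))) ≤ 4 * p * (1 - δ) * s ^ 2 := by
    have e : Λ₀ * (((1 + δ) * s ^ 2) * (p * (1 + δ / 2))) = (Λ₀ * (1 + δ) * (1 + δ / 2)) * (p * s ^ 2) := by
      ring
    have h6 : Λ₀ * (1 + δ) * (1 + δ / 2) ≤ 4 * ((1 - 3 * δ) * (1 + δ) * (1 + δ / 2)) := by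
      have : 0 ≤ (1 + δ) * (1 + δ / 2) := by positivity
      nlinarith
    have hps : 0 ≤ p * s ^ 2 := by positivity
    rw [e]
    nlinarith [mul_le_mul_of_nonneg_right h6 hps, mul_le_mul_of_nonneg_right h4 hps]
  have h7 : 4 * p * (1 - δ) * s ^ 2 ≤ 4 * p * (1 - m) * s ^ 2 := by
    have hps : 0 ≤ p * s ^ 2 := by positivity
    nlinarith
  linarith

/-- Gain case (pure algebra): with `S ≤ s²`, `4Λ₀ + 2Λ₀δ ≤ Sε²`, `mS = pδ/4`, `m ≤ p/4`, `0 < S`,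
`Λ₀ ≤ ε²(p/2−m)s²/(p+2ms²)`. -/
theorem gain_case {p m δ Λ₀ S ε s : ℝ} (hp : 0 < p) (hm : 0 ≤ m) (hΛ0 : 0 ≤ Λ₀) (hS : 0 < S)
    (hsS : S ≤ s ^ 2) (hSε : 4 * Λ₀ + 2 * Λ₀ * δ ≤ S * ε ^ 2) (hmS : m * S = p * δ / 4) (hm4 : m ≤ p / 4) :
    Λ₀ ≤ ε ^ 2 * (p / 2 - m) * s ^ 2 / (p + 2 * m * s ^ 2) := by
  have hc : 0 < p + 2 * m * s ^ 2 := by positivity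
  rw [le_div_iff₀ hc]
  -- the bracket `B = ε²(p/2−m) − 2Λ₀m ≥ (p/(4S))(Sε² − 2Λ₀δ) ≥ 0` and `S·B ≥ Λ₀ p`
  have hB : Λ₀ * p ≤ S * (ε ^ 2 * (p / 2 - m) - 2 * Λ₀ * m) := by
    have e : S * (ε ^ 2 * (p / 2 - m) - 2 * Λ₀ * m) = S * ε ^ 2 * (p / 2 - m) - 2 * Λ₀ * (m * S) := by ring
    rw [e, hmS]
    have h1 : S * ε ^ 2 * (p / 4) ≤ S * ε ^ 2 * (p / 2 - m) :=
      mul_le_mul_of_nonneg_left (by linarith) (by positivity)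
    nlinarith
  have hB0 : 0 ≤ ε ^ 2 * (p / 2 - m) - 2 * Λ₀ * m := by
    by_contra h
    push Not at h
    have : S * (ε ^ 2 * (p / 2 - m) - 2 * Λ₀ * m) < 0 := mul_neg_of_pos_of_neg hS h
    nlinarith
  have h2 : S * (ε ^ 2 * (p / 2 - m) - 2 * Λ₀ * m) ≤ s ^ 2 * (ε ^ 2 * (p / 2 - m) - 2 * Λ₀ * m) :=
    mul_le_mul_of_nonneg_right hsS hB0
  nlinarith

/-- **Parameters for a thin core.** For `0 < p < 2`, an outer level `0 < Λ₀ < 4` and ANY core width `ξ₀ > 0`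
there are `m, ε` (`0 < m < p/2`, `2m ≤ 1`, `ε > 0`) with `D_{p,m,ε}(ξ) ≥ Λ₀` for all `ξ ≥ ξ₀`: with
`δ = (4 − Λ₀)/12`, `ε = ξ₀√δ`, `S = (4Λ₀ + 2Λ₀δ)/ε² + 1/δ`, `m = pδ/(4S)`, the hump covers `1/δ ≤ s² ≤ S` and the
gain covers `s² ≥ S` (`s = ξ/ε`). [new] -/
theorem exists_thinCore_params {p Λ₀ ξ₀ : ℝ} (hp : 0 < p) (hp2 : p < 2) (hΛ0 : 0 < Λ₀) (hΛ4 : Λ₀ < 4)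
    (hξ₀ : 0 < ξ₀) :
    ∃ m ε : ℝ, 0 < m ∧ m < p / 2 ∧ 2 * m ≤ 1 ∧ 0 < ε ∧ ∀ ξ : ℝ, ξ₀ ≤ ξ →
      Λ₀ ≤ (p * (2 - p) + 4 * p * (1 - m) * (ξ / ε) ^ 2 + 4 * m * (1 - m) * (ξ / ε) ^ 4
          + ε ^ 2 * (p / 2 - m) * (ξ / ε) ^ 2 * (1 + (ξ / ε) ^ 2))
        / ((1 + (ξ / ε) ^ 2) * (p + 2 * m * (ξ / ε) ^ 2)) := by
  set δ : ℝ := (4 - Λ₀) / 12 with hδ_def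
  have hδ : 0 < δ := by rw [hδ_def]; linarith
  have hδ3 : δ ≤ 1 / 3 := by rw [hδ_def]; linarith
  have hΛδ : Λ₀ ≤ 4 * (1 - 3 * δ) := by rw [hδ_def]; linarith
  set ε : ℝ := ξ₀ * √δ with hε_def
  have hsq : √δ ^ 2 = δ := Real.sq_sqrt hδ.le
  have hsqpos : 0 < √δ := Real.sqrt_pos.2 hδ
  have hε : 0 < ε := mul_pos hξ₀ hsqpos
  have hε2 : ε ^ 2 = ξ₀ ^ 2 * δ := by rw [hε_def, mul_pow, hsq]
  set S : ℝ := (4 * Λ₀ + 2 * Λ₀ * δ) / ε ^ 2 + 1 / δ with hS_def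
  have hS1 : 1 / δ ≤ S := by
    rw [hS_def]; exact le_add_of_nonneg_left (by positivity)
  have hδ1 : 3 ≤ 1 / δ := by
    rw [le_div_iff₀ hδ]; linarith
  have hS3 : 3 ≤ S := hδ1.trans hS1
  have hS : 0 < S := by linarith
  have hSε : 4 * Λ₀ + 2 * Λ₀ * δ ≤ S * ε ^ 2 := by
    rw [hS_def, add_mul, div_mul_cancel₀ _ (pow_pos hε 2).ne']
    exact le_add_of_nonneg_right (by positivity)
  set m : ℝ := p * δ / (4 * S) with hm_def
  have hm : 0 < m := by rw [hm_def]; positivity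
  have hmS : m * S = p * δ / 4 := by rw [hm_def]; field_simp
  have hm4 : m ≤ p / 4 := by
    rw [hm_def, div_le_div_iff₀ (by positivity) (by norm_num)]
    nlinarith
  have hmδ : m ≤ δ := by
    rw [hm_def, div_le_iff₀ (by positivity)]
    nlinarith
  refine ⟨m, ε, hm, by linarith, by nlinarith, hε, fun ξ hξ => ?_⟩
  have hξpos : 0 < ξ := hξ₀.trans_le hξ
  set s : ℝ := ξ / ε with hs_def
  have hs2 : 1 ≤ δ * s ^ 2 := by
    rw [hs_def, div_pow, hε2]
    have hx : ξ₀ ^ 2 ≤ ξ ^ 2 := pow_le_pow_left₀ hξ₀.le hξ 2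
    rw [show δ * (ξ ^ 2 / (ξ₀ ^ 2 * δ)) = ξ ^ 2 / ξ₀ ^ 2 by field_simp, le_div_iff₀ (pow_pos hξ₀ 2)]
    linarith
  rcases le_or_gt (s ^ 2) S with hle | hgt
  · -- hump
    have hms : 2 * m * s ^ 2 ≤ p * δ / 2 := by nlinarith [mul_le_mul_of_nonneg_left hle hm.le]
    exact (hump_case hp hm.le hδ hmδ hΛδ hΛ0.le hs2 hms).trans
      (scaledReynolds_ge_hump hp hp2.le hm.le (by linarith) (by linarith) ε s)
  · -- gain
    exact (gain_case hp hm.le hΛ0.le hS hgt.le hSε hmS hm4).trans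
      (scaledReynolds_ge_gain hp hp2.le hm.le (by linarith) ε s)

/-- **Two-level inflow criterion with an arbitrarily thin subcritical core (outer level below `4`).**  For every
core level `0 < d₀ < 2`, every outer level `0 < Λ₀ < 4` and EVERY core width `ξ₀ > 0`: an axisymmetric classical
Leray–Hopf solution of the standing class on `[0,T)` at viscosity `ν` whose inflow Reynolds number `−r u_r/ν` is
`≤ d₀` at the points of the unit tube with `r < ξ₀√(ν(T−t))` and `≤ Λ₀` at those with `r ≥ ξ₀√(ν(T−t))` extends
smoothly past `T`.  Contrast with the tree's `RadialInflowCoreReynolds.exists_coreWidth_twoLevelReynolds`: there the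
outer level is arbitrary but the core width `ξ₀(d₀,Λ₀) ≥ 1` is dictated; here the outer level is `< 4` but the core is
as thin as one likes (Leray's similarity fixes `r/√(ν(T−t))`, so this is not a rescaling of that theorem).  Proof:
`hasSmoothExtensionPast_of_scaledCoreReynolds` with the parameters of `exists_thinCore_params`. [new] -/
theorem twoLevelReynolds_thinCore {d₀ Λ₀ ξ₀ ν T : ℝ}
    {u : ℝ → EuclideanSpace ℝ (Fin 3) → EuclideanSpace ℝ (Fin 3)} {p : ℝ → EuclideanSpace ℝ (Fin 3) → ℝ}
    (hd0 : 0 < d₀) (hd2 : d₀ < 2) (hΛ0 : 0 < Λ₀) (hΛ4 : Λ₀ < 4) (hξ₀ : 0 < ξ₀) (hν : 0 < ν) (hT : 0 < T)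
    (hcl : IsClassicalNSSolutionOn (Ico 0 T) ν 0 u p) (hLH : IsLerayHopfOn T ν 0 (u 0) u)
    (hdec : HasRapidSpatialDecay (u 0)) (hax : ∀ t ∈ Ico 0 T, IsAxisymmetric (u t))
    (hcore : ∀ t ∈ Ico 0 T, ∀ x : EuclideanSpace ℝ (Fin 3), 0 < cylRadius x → cylRadius x ≤ 1 →
      cylRadius x < ξ₀ * √(ν * (T - t)) → -(ν * d₀ / cylRadius x) ≤ radialVelocity (u t) x)
    (hfar : ∀ t ∈ Ico 0 T, ∀ x : EuclideanSpace ℝ (Fin 3), 0 < cylRadius x → cylRadius x ≤ 1 →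
      ξ₀ * √(ν * (T - t)) ≤ cylRadius x → -(ν * Λ₀ / cylRadius x) ≤ radialVelocity (u t) x) :
    HasSmoothExtensionPast ν 0 u T := by
  have hp : 0 < 2 - d₀ := by linarith
  have hp2 : 2 - d₀ < 2 := by linarith
  obtain ⟨m, ε, hm, hmp, h2m, hε, hD⟩ := exists_thinCore_params hp hp2 hΛ0 hΛ4 hξ₀
  refine hasSmoothExtensionPast_of_scaledCoreReynolds hp hp2 hm hmp h2m hε hν hT hcl hLH hdec hax
    fun t ht x hx hx1 => ?_
  set lam : ℝ := √(ν * (T - t)) with hlam_def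
  have hlam : 0 < lam := Real.sqrt_pos.2 (mul_pos hν (by linarith [ht.2]))
  set ξ : ℝ := cylRadius x / lam with hξ_def
  -- the profile dominates both levels where they are assumed
  have hDcore : d₀ ≤ (((2 - d₀) * (2 - (2 - d₀)) + 4 * (2 - d₀) * (1 - m) * (ξ / ε) ^ 2
        + 4 * m * (1 - m) * (ξ / ε) ^ 4 + ε ^ 2 * ((2 - d₀) / 2 - m) * (ξ / ε) ^ 2 * (1 + (ξ / ε) ^ 2))
      / ((1 + (ξ / ε) ^ 2) * ((2 - d₀) + 2 * m * (ξ / ε) ^ 2))) := by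
    have h := scaledReynolds_ge_core hp hm.le hmp.le ε (ξ / ε)
    linarith
  have hmono : ∀ L D : ℝ, L ≤ D → -(ν * L / cylRadius x) ≤ radialVelocity (u t) x →
      -(ν * D / cylRadius x) ≤ radialVelocity (u t) x := by
    intro L D hLD hL
    refine le_trans ?_ hL
    rw [neg_le_neg_iff]
    exact div_le_div_of_nonneg_right (mul_le_mul_of_nonneg_left hLD hν.le) hx.le
  by_cases hcr : cylRadius x < ξ₀ * lam
  · exact hmono _ _ hDcore (hcore t ht x hx hx1 hcr)
  · push Not at hcr
    have hξ₀ξ : ξ₀ ≤ ξ := by rw [hξ_def, le_div_iff₀ hlam]; exact hcr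
    exact hmono _ _ (hD ξ hξ₀ξ) (hfar t ht x hx hx1 hcr)

end Summit.NavierStokesRegularity.NavierStokesRegularity.Theorems.RadialInflowThinCore

end
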